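import Literature.Algebra.Lie.LefschetzAlgebra
import Literature.Algebra.Lie.LefschetzModulePolarization
import Literature.Algebra.Lie.LefschetzModulePrimitive
import Mathlib.Algebra.DualNumber
import HarnessLib

/-!
# Validation instance for Lefschetz algebras: `H^•(ℙ¹) = K[ε]/(ε²)`, `deg ε = 2`, is a Lefschetz algebra of depth `1` (Looijenga–Lunts 1997, §1 (1.4))

Topic `Literature/Algebra/Lie` (namespace `Literature.Algebra.Lie.LefschetzDualNumber`).  Lane `lit-hodgefound` (Track 2
foundations library), skeleton seat `lit-hodgefound-skel-1` (generation 43), row **A1-121** of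
`run/shared/lean/pub/lit-hodgefound/SKELETON.md`: the NON-VACUITY WITNESS for row A1-119's `IsLefschetzAlgebra`
(`LefschetzAlgebra.lean`, Looijenga–Lunts (1.4)) asked for by its reviewer ("no model of `IsLefschetzAlgebra` is
constructed … a toy construction (K[x]/(x²), deg x = 2) would be a cheap non-vacuity witness for the series"), as tree
theorems — in the manner of rows A1-95/A1-100 (`LefschetzStringTwo.lean`, the `𝔰𝔩₂`-string of length two validating
A1-88/A1-96).  The algebra is Mathlib's dual numbers `DualNumber K = K[ε]/(ε²)` (`TrivSqZeroExt K K`), graded with `ε`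
in degree `2` — the cohomology algebra `H^•(ℙ¹; K)` with `ε` the hyperplane class, the simplest instance of
Looijenga–Lunts' standing example "the cohomology algebra of a projective manifold is a Lefschetz algebra".  Every
hypothesis of (1.4) and of (1.6) is instantiated on a concrete object, none vacuously: `A_0 = K`, `A_2 = K·ε`,
graded-commutative, `A[1] = A_0 ⊕ A_2` in degrees `-1, 1`, `𝔞 = {L_a | a ∈ A_2} = K·L_ε` with the Lefschetz element
`L_ε : A_0 ≅ A_2`, the form `φ(a, b) = (-1)^q ∫(ab)` of (1.4) with `∫ =` the `ε`-coefficient is the standard symplectic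
form `φ(x, y) = x₁ y₀ - x₀ y₁` (non-degenerate, `(-1)^1`-symmetric), `L_ε` POLARIZES `(A[1], φ)` in the sense of (1.6) /
A1-96 (`φ(ε·c, c) = c²`), so `(A_2, A[1])` is a Lefschetz module by A1-96 `isLefschetzModule_of_polarization`
(`𝔤(A_2, A[1])` semisimple — it is the `𝔰𝔩₂` spanned by `L_ε`, `h`, `f`), of depth `1`; whence
**`isLefschetzAlgebra : IsLefschetzAlgebra K (grading K) 1`**; and `A[1]` is IRREDUCIBLE over `𝔤(A_2, A[1])`
(`isIrreducible`, via the `𝔰𝔩₂`-triple `(L_ε, h, f)` of §5), so `(A[1], φ)` is an irreducible symplectic Lefschetz module.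

One definition with a body is introduced for the grading (`grading`), and one for the graded-algebra STRUCTURE
(`gradedAlgebra`, a `def` of class type built from `DirectSum.IsInternal.chooseDecomposition`, enabled as an instance
only inside this file by a FILE-LOCAL attribute — no global instance is declared); no named fact, no `sorry`
(D-0026 net debt `0`).  `LieRing.ofAssociativeRing` on `𝔤𝔩(A)` is enabled file-locally as in the rest of the series.

## Source, VERBATIM

E. Looijenga, V. A. Lunts, *A Lie algebra attached to a projective variety*, Invent. Math. **129** (1997) 361–412,
§1 (1.4) (held TeX text `paper:arxiv-alg-geom_9604014`, p0005 L17–L29):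

> "(1.4) Many Lefschetz modules have the additional structure of an algebra. Let `A = ⊕_{i=0}^{2n} A_i` be a
> graded-commutative algebra with `A_0 = K`. We say that `A` is a Lefschetz algebra of depth `n` if `A[n]` is a
> Lefschetz module of depth `n` over `A_2`. Such a Lefschetz module can be endowed with an invariant `(-)^n`-symmetric
> bilinear form: let `∫ : A → K` be a linear form that is an isomorphism in degree `2n` and zero in all other degrees
> and define `φ(a, b) := (-1)^q ∫(ab)` if `a` is homogeneous of degree `n + 2q` or `n + 2q + 1`. If this form is
> nondegenerate (which is for instance the case when `A[n]` is irreducible as a Lefschetz module), then the form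
> `(a, b) ↦ ∫(ab)` is also nondegenerate and so `A` becomes a Frobenius algebra (in the graded sense)."

and (1.6) (p0005 L76–L84, the Proposition "Then `M` is a Lefschetz module of `𝔞`", formalised as A1-96
`isLefschetzModule_of_polarization`), applied here with the polarization `L_ε`.  The example itself
(`H^•(ℙ¹) = K[ε]/(ε²)`) is the case `X = ℙ¹` of the paper's introduction ("if `X` is a projective manifold, then its
cohomology algebra is a Lefschetz algebra"); it is recorded as a VALIDATION INSTANCE, not as a result of the paper.

## Contents (all proved)

* §1 `grading K : ℕ → Submodule K (DualNumber K)` (`A_0 = K·1 = range (algebraMap K _)`, `A_2 = K·ε = range inr`,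
  `A_i = ⊥` otherwise; `mem_grading_zero_iff : x ∈ A_0 ↔ x₁ = 0`, `mem_grading_two_iff : x ∈ A_2 ↔ x₀ = 0`),
  `gradedMonoid` (`1 ∈ A_0`, `A_i A_j ⊆ A_{i+j}`), `iSup_grading_eq_top`, `iSupIndep_grading`, `isInternal_grading`
  (`A = ⊕ A_i`), `gradedAlgebra` (the `GradedAlgebra` structure, a `def`).
* §2 `isGradedCommutative` (commutative and evenly graded).
* §3 the form: `sndHom_eq_zero_of_mem` (`∫` vanishes off degree `2`), **`lefschetzForm_apply_eq`**
  (`φ(x, y) = x₁ y₀ - x₀ y₁`), `lefschetzForm_swap` (`φ(y, x) = -φ(x, y)`), `isRefl_lefschetzForm`,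
  **`nondegenerate_lefschetzForm`**, `mul_eps_mem` (`L_ε ∈ 𝔞`), `mulLeftDegTwo_eq_span` (`𝔞 = K·L_ε`).
* §4 (`K` of characteristic `0`) `degreeSpace_neg_one : A[1]_{-1} = A_0`, `degreeSpace_one : A[1]_1 = A_2`,
  `degreeSpace_eq_bot` (other degrees), `shiftedDegree_ne_zero`, **`polarization`** (the hypothesis `hpol` of A1-96),
  **`isLefschetzModule : IsLefschetzModule K (shiftedDegree K (grading K) 1) (mulLeftDegTwo K (grading K))`**,
  **`depth_eq_one`**, **`isLefschetzAlgebra : IsLefschetzAlgebra K (grading K) 1`**.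
* §5 `shiftedDegree_apply_eq` (`h x = -x₀ + x₁ ε`), `mul_eps_apply_eq` (`L_ε x = x₀ ε`), `lowering_apply_eq`
  (`f x = x₁`), **`isSl2Triple`** (`(L_ε, h, f)` is an `𝔰𝔩₂`-triple, Mathlib `IsSl2Triple`),
  `lowering_mem_lefschetzLieAlgebra` (`f ∈ 𝔤(A_2, A[1])`), **`isIrreducible`** (`A[1]` is irreducible over
  `𝔤(A_2, A[1])`, Mathlib `LieModule.IsIrreducible` — so `(A[1], φ)` is an irreducible symplectic Lefschetz module,
  (1.3), and the parenthetical of (1.4) "nondegenerate … when `A[n]` is irreducible" is instantiated non-vacuously).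

## SCOPE

(a) Only the depth-`1` example `H^•(ℙ¹)` is built; `H^•(ℙⁿ) = K[x]/(x^{n+1})` (depth `n`) and the cohomology algebras of
complex tori (the lane's `ComplexTorus*` files) are not treated here.  (b) `𝔤(A_2, A[1]) ≅ 𝔰𝔩₂(K)` is not spelled
out as an isomorphism (semisimplicity comes abstractly from (1.6), irreducibility from §5).  (c) Nothing here concerns
the Hodge conjecture.

## References

* [LooijengaLunts1997] E. Looijenga, V. A. Lunts, *A Lie algebra attached to a projective variety*, Invent. Math. 129
  (1997) 361–412; arXiv:alg-geom/9604014. §1 (1.4) p. 5 L17–L29, (1.6) p. 5 L59–p. 6 L20 of the held TeX text;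
  introduction (cohomology algebras of projective manifolds are Lefschetz algebras).
-/

noncomputable section

namespace Literature.Algebra.Lie.LefschetzDualNumber

open TrivSqZeroExt DualNumber Module

-- The commutator Lie ring of `𝔤𝔩(A) = Module.End K A`: Mathlib's reducible NON-instance, enabled file-locally
-- exactly as in `LefschetzModule.lean` / `LefschetzAlgebra.lean`.
attribute [local instance 100] LieRing.ofAssociativeRing

/-! ### §1 The grading `A_0 = K·1`, `A_2 = K·ε` of the dual numbers -/

section Grading

variable (K : Type*) [Field K]

/-- The grading of `A = K[ε]/(ε²)` with `ε` in degree `2`: `A_0 = K·1`, `A_2 = K·ε`, `A_i = 0` otherwise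
(`H^•(ℙ¹; K)`, `ε` = the hyperplane class). [cite: LooijengaLunts1997, §1 (1.4) p. 5 L17–L20] -/
def grading (i : ℕ) : Submodule K (DualNumber K) :=
  if i = 0 then LinearMap.range (Algebra.linearMap K (DualNumber K))
  else if i = 2 then LinearMap.range (TrivSqZeroExt.inrHom K K) else ⊥

/-- `A_0 = K·1`. [cite: LooijengaLunts1997, §1 (1.4) p. 5 L17–L20 ("with A_0 = K")] -/
theorem grading_zero : grading K 0 = LinearMap.range (Algebra.linearMap K (DualNumber K)) := by
  simp [grading]

/-- `A_2 = K·ε`. [cite: LooijengaLunts1997, §1 (1.4) p. 5 L17–L20] -/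
theorem grading_two : grading K 2 = LinearMap.range (TrivSqZeroExt.inrHom K K) := by
  simp [grading]

/-- `A_i = 0` for `i ∉ {0, 2}`. [cite: LooijengaLunts1997, §1 (1.4) p. 5 L17–L20] -/
theorem grading_of_ne {i : ℕ} (h0 : i ≠ 0) (h2 : i ≠ 2) : grading K i = ⊥ := by
  simp [grading, h0, h2]

variable {K}

/-- `x ∈ A_0 ↔ x = x₀·1`. [cite: LooijengaLunts1997, §1 (1.4) p. 5 L17–L20] -/
theorem mem_grading_zero_iff {x : DualNumber K} : x ∈ grading K 0 ↔ x.snd = 0 := by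
  rw [grading_zero, LinearMap.mem_range]
  constructor
  · rintro ⟨c, rfl⟩
    rw [Algebra.linearMap_apply, algebraMap_eq_inl, snd_inl]
  · intro h
    refine ⟨x.fst, ?_⟩
    rw [Algebra.linearMap_apply, algebraMap_eq_inl]
    exact TrivSqZeroExt.ext (by rw [fst_inl]) (by rw [snd_inl, h])

/-- `x ∈ A_2 ↔ x = x₁·ε`. [cite: LooijengaLunts1997, §1 (1.4) p. 5 L17–L20] -/
theorem mem_grading_two_iff {x : DualNumber K} : x ∈ grading K 2 ↔ x.fst = 0 := by
  rw [grading_two, LinearMap.mem_range]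
  constructor
  · rintro ⟨c, rfl⟩
    rw [inrHom_apply, fst_inr]
  · intro h
    refine ⟨x.snd, ?_⟩
    rw [inrHom_apply]
    exact TrivSqZeroExt.ext (by rw [fst_inr, h]) (by rw [snd_inr])

/-- `c·1 ∈ A_0`. [cite: LooijengaLunts1997, §1 (1.4) p. 5 L17–L20] -/
theorem inl_mem_grading_zero (c : K) : (inl c : DualNumber K) ∈ grading K 0 :=
  mem_grading_zero_iff.2 (snd_inl K c)

/-- `c·ε ∈ A_2`. [cite: LooijengaLunts1997, §1 (1.4) p. 5 L17–L20] -/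
theorem inr_mem_grading_two (c : K) : (inr c : DualNumber K) ∈ grading K 2 :=
  mem_grading_two_iff.2 (fst_inr K c)

/-- `ε ∈ A_2`. [cite: LooijengaLunts1997, §1 (1.4) p. 5 L17–L20] -/
theorem eps_mem_grading_two : (ε : DualNumber K) ∈ grading K 2 :=
  inr_mem_grading_two 1

/-- A member of `A_i` is `0` unless `i ∈ {0, 2}` (`A = A_0 ⊕ A_2`). [cite: LooijengaLunts1997, §1 (1.4) p. 5 L17–L20] -/
theorem eq_zero_of_mem_grading {i : ℕ} (h0 : i ≠ 0) (h2 : i ≠ 2) {x : DualNumber K} (hx : x ∈ grading K i) :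
    x = 0 := by
  rw [grading_of_ne K h0 h2, Submodule.mem_bot] at hx
  exact hx

variable (K)

/-- `1 ∈ A_0` and `A_i A_j ⊆ A_{i+j}`. [cite: LooijengaLunts1997, §1 (1.4) p. 5 L17–L20] -/
theorem gradedMonoid : SetLike.GradedMonoid (grading K) where
  one_mem := mem_grading_zero_iff.2 snd_one
  mul_mem := by
    intro i j x y hx hy
    by_cases hi0 : i = 0
    · subst hi0
      by_cases hj0 : j = 0
      · subst hj0
        rw [mem_grading_zero_iff] at hx hy ⊢
        rw [DualNumber.snd_mul, hx, hy, mul_zero, zero_mul, add_zero]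
      by_cases hj2 : j = 2
      · subst hj2
        rw [mem_grading_zero_iff] at hx
        rw [mem_grading_two_iff] at hy
        rw [zero_add, mem_grading_two_iff, fst_mul, hy, mul_zero]
      · rw [eq_zero_of_mem_grading hj0 hj2 hy, mul_zero]
        exact Submodule.zero_mem _
    by_cases hi2 : i = 2
    · subst hi2
      by_cases hj0 : j = 0
      · subst hj0
        rw [mem_grading_two_iff] at hx
        rw [add_zero, mem_grading_two_iff, fst_mul, hx, zero_mul]
      by_cases hj2 : j = 2
      · subst hj2
        rw [mem_grading_two_iff] at hx hy
        have : x * y = 0 := TrivSqZeroExt.ext (by rw [fst_mul, hx, zero_mul, fst_zero])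
          (by rw [DualNumber.snd_mul, hx, hy, zero_mul, mul_zero, add_zero, snd_zero])
        rw [this]
        exact Submodule.zero_mem _
      · rw [eq_zero_of_mem_grading hj0 hj2 hy, mul_zero]
        exact Submodule.zero_mem _
    · rw [eq_zero_of_mem_grading hi0 hi2 hx, zero_mul]
      exact Submodule.zero_mem _

/-- `A = ⊕ A_i`: the pieces span. [cite: LooijengaLunts1997, §1 (1.4) p. 5 L17–L20] -/
theorem iSup_grading_eq_top : ⨆ i, grading K i = ⊤ := by
  rw [eq_top_iff]
  intro x _
  have hx : x = inl x.fst + inr x.snd := (inl_fst_add_inr_snd_eq x).symm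
  rw [hx]
  exact Submodule.add_mem _ (Submodule.mem_iSup_of_mem 0 (inl_mem_grading_zero x.fst))
    (Submodule.mem_iSup_of_mem 2 (inr_mem_grading_two x.snd))

/-- `A = ⊕ A_i`: the pieces are independent. [cite: LooijengaLunts1997, §1 (1.4) p. 5 L17–L20] -/
theorem iSupIndep_grading : iSupIndep (grading K) := by
  rw [iSupIndep_def]
  intro i
  by_cases hi0 : i = 0
  · subst hi0
    have hle : ⨆ j ≠ (0 : ℕ), grading K j ≤ grading K 2 := by
      refine iSup₂_le fun j hj ↦ ?_
      by_cases hj2 : j = 2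
      · rw [hj2]
      · rw [grading_of_ne K hj hj2]
        exact bot_le
    refine Disjoint.mono_right hle ?_
    rw [Submodule.disjoint_def]
    intro x hx hx'
    exact TrivSqZeroExt.ext (by rw [mem_grading_two_iff.1 hx', fst_zero]) (by rw [mem_grading_zero_iff.1 hx, snd_zero])
  by_cases hi2 : i = 2
  · subst hi2
    have hle : ⨆ j ≠ (2 : ℕ), grading K j ≤ grading K 0 := by
      refine iSup₂_le fun j hj ↦ ?_
      by_cases hj0 : j = 0
      · rw [hj0]
      · rw [grading_of_ne K hj0 hj]
        exact bot_le
    refine Disjoint.mono_right hle ?_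
    rw [Submodule.disjoint_def]
    intro x hx hx'
    exact TrivSqZeroExt.ext (by rw [mem_grading_two_iff.1 hx, fst_zero]) (by rw [mem_grading_zero_iff.1 hx', snd_zero])
  · rw [grading_of_ne K hi0 hi2]
    exact disjoint_bot_left

/-- `A = ⊕ A_i` (internal direct sum). [cite: LooijengaLunts1997, §1 (1.4) p. 5 L17–L20] -/
theorem isInternal_grading : DirectSum.IsInternal (grading K) :=
  (DirectSum.isInternal_submodule_iff_iSupIndep_and_iSup_eq_top _).2 ⟨iSupIndep_grading K, iSup_grading_eq_top K⟩

/-- The graded-algebra structure of `(K[ε]/(ε²), deg ε = 2)` (a `def`, enabled as an instance only inside this file).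
[cite: LooijengaLunts1997, §1 (1.4) p. 5 L17–L20] -/
@[reducible] def gradedAlgebra : GradedAlgebra (grading K) :=
  { gradedMonoid K, (isInternal_grading K).chooseDecomposition with }

end Grading


/-! ### §2 Graded-commutativity -/

section Model

variable (K : Type*) [Field K]

attribute [local instance] gradedAlgebra

open HasLefschetzProperty (primitiveSpace)

/-- `K[ε]/(ε²)` (commutative, concentrated in even degrees) is graded-commutative.
[cite: LooijengaLunts1997, §1 (1.4) p. 5 L18] -/
theorem isGradedCommutative : IsGradedCommutative K (grading K) := by
  refine ⟨fun i j x y hx hy ↦ ?_⟩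
  by_cases hi : i ≠ 0 ∧ i ≠ 2
  · rw [eq_zero_of_mem_grading hi.1 hi.2 hx, mul_zero, zero_mul, smul_zero]
  by_cases hj : j ≠ 0 ∧ j ≠ 2
  · rw [eq_zero_of_mem_grading hj.1 hj.2 hy, mul_zero, zero_mul, smul_zero]
  have he : Even (i * j) := by
    rcases not_and_or.1 hi with h | h <;> rcases not_and_or.1 hj with h' | h' <;> simp only [not_not] at h h' <;>
      subst h <;> subst h' <;> decide
  rw [he.neg_one_pow, one_smul, mul_comm]

/-! ### §3 The form `φ(a, b) = (-1)^q ∫(ab)` with `∫ = ` the `ε`-coefficient: `φ(x, y) = x₁ y₀ - x₀ y₁` -/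

/-- `∫` (the `ε`-coefficient) vanishes off degree `2 = 2n`. [cite: LooijengaLunts1997, §1 (1.4) p. 5 L21–L23] -/
theorem sndHom_eq_zero_of_mem {i : ℕ} (hi : i ≠ 2 * 1) {x : DualNumber K} (hx : x ∈ grading K i) :
    TrivSqZeroExt.sndHom K K x = 0 := by
  by_cases h0 : i = 0
  · subst h0
    exact mem_grading_zero_iff.1 hx
  · rw [eq_zero_of_mem_grading h0 (by omega) hx, map_zero]

/-- **`φ(x, y) = x₁ y₀ - x₀ y₁`** for `x = x₀ + x₁ ε`, `y = y₀ + y₁ ε`: the form of (1.4) on `H^•(ℙ¹)` is the standard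
symplectic form (`φ(1, ε) = (-1)^{⌊(0-1)/2⌋} ∫ε = -1`, `φ(ε, 1) = (-1)^{⌊(2-1)/2⌋} ∫ε = 1`).
[cite: LooijengaLunts1997, §1 (1.4) p. 5 L21–L25] -/
theorem lefschetzForm_apply_eq (x y : DualNumber K) :
    lefschetzForm K (grading K) 1 (TrivSqZeroExt.sndHom K K) x y = x.snd * y.fst - x.fst * y.snd := by
  have hx : x = inl x.fst + inr x.snd := (inl_fst_add_inr_snd_eq x).symm
  conv_lhs => rw [hx]
  rw [map_add, LinearMap.add_apply, lefschetzForm_apply_of_mem K (grading K) 1 _ (inl_mem_grading_zero x.fst),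
    lefschetzForm_apply_of_mem K (grading K) 1 _ (inr_mem_grading_two x.snd)]
  rw [show ((((0 : ℕ) : ℤ) - (1 : ℕ)) / 2).natAbs = 1 by decide, show ((((2 : ℕ) : ℤ) - (1 : ℕ)) / 2).natAbs = 0 by decide,
    pow_one, pow_zero, one_smul, sndHom_apply, sndHom_apply, DualNumber.snd_mul, DualNumber.snd_mul, fst_inl, snd_inl,
    fst_inr, snd_inr]
  ring

/-- `φ` is alternating in the strong sense `φ(y, x) = -φ(x, y)` (the `(-1)^1`-symmetry of (1.4)).
[cite: LooijengaLunts1997, §1 (1.4) p. 5 L23] -/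
theorem lefschetzForm_swap (x y : DualNumber K) :
    lefschetzForm K (grading K) 1 (TrivSqZeroExt.sndHom K K) y x =
      -lefschetzForm K (grading K) 1 (TrivSqZeroExt.sndHom K K) x y := by
  rw [lefschetzForm_apply_eq, lefschetzForm_apply_eq]
  ring

/-- `φ` is reflexive. [cite: LooijengaLunts1997, §1 (1.4) p. 5 L23] -/
theorem isRefl_lefschetzForm : (lefschetzForm K (grading K) 1 (TrivSqZeroExt.sndHom K K)).IsRefl := by
  intro x y h
  rw [lefschetzForm_swap, h, neg_zero]

/-- **`φ` is non-degenerate** on `H^•(ℙ¹)` (Poincaré duality: `φ(x, 1) = x₁`, `φ(x, ε) = -x₀`).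
[cite: LooijengaLunts1997, §1 (1.4) p. 5 L25–L29] -/
theorem nondegenerate_lefschetzForm : (lefschetzForm K (grading K) 1 (TrivSqZeroExt.sndHom K K)).Nondegenerate := by
  have key : ∀ x : DualNumber K, lefschetzForm K (grading K) 1 (TrivSqZeroExt.sndHom K K) x 1 = 0 →
      lefschetzForm K (grading K) 1 (TrivSqZeroExt.sndHom K K) x ε = 0 → x = 0 := by
    intro x h1 h2
    rw [lefschetzForm_apply_eq, fst_one, snd_one, mul_one, mul_zero, sub_zero] at h1
    rw [lefschetzForm_apply_eq, fst_eps, snd_eps, mul_zero, mul_one, zero_sub, neg_eq_zero] at h2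
    exact TrivSqZeroExt.ext (h2.trans fst_zero.symm) (h1.trans snd_zero.symm)
  refine ⟨fun x hx ↦ key x (hx 1) (hx ε), fun y hy ↦ key y ?_ ?_⟩
  · rw [lefschetzForm_swap, hy 1, neg_zero]
  · rw [lefschetzForm_swap, hy ε, neg_zero]

/-- `K[ε]/(ε²)` is `2`-dimensional, in particular finite-dimensional (spanned by `1, ε`; plumbing — Mathlib has no
`Module.Finite` instance for `TrivSqZeroExt`). [folklore] -/
private theorem finiteDimensional : FiniteDimensional K (DualNumber K) := by
  refine Module.Finite.of_surjective ((Algebra.linearMap K (DualNumber K)).coprod (TrivSqZeroExt.inrHom K K)) fun x ↦ ?_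
  refine ⟨(x.fst, x.snd), ?_⟩
  rw [LinearMap.coprod_apply, Algebra.linearMap_apply, algebraMap_eq_inl, inrHom_apply, inl_fst_add_inr_snd_eq]

/-- `L_ε ∈ {L_a | a ∈ A_2}`. [cite: LooijengaLunts1997, §1 (1.4) p. 5 L19–L20] -/
theorem mul_eps_mem : LinearMap.mul K (DualNumber K) ε ∈ mulLeftDegTwo K (grading K) :=
  (mem_mulLeftDegTwo_iff K (grading K)).2 ⟨ε, eps_mem_grading_two, rfl⟩

/-- `A_2 = K·ε`. [cite: LooijengaLunts1997, §1 (1.4) p. 5 L17–L20] -/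
theorem grading_two_eq_span : grading K 2 = K ∙ (ε : DualNumber K) := by
  refine le_antisymm (fun x hx ↦ ?_) ((Submodule.span_singleton_le_iff_mem _ _).2 eps_mem_grading_two)
  rw [grading_two, LinearMap.mem_range] at hx
  obtain ⟨c, rfl⟩ := hx
  rw [inrHom_apply, inr_eq_smul_eps]
  exact Submodule.smul_mem _ c (Submodule.mem_span_singleton_self _)

/-- **`𝔞 = {L_a | a ∈ A_2} = K·L_ε`**: the `𝔞` of this Lefschetz algebra is the line spanned by `L_ε`.
[cite: LooijengaLunts1997, §1 (1.4) p. 5 L19–L20] -/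
theorem mulLeftDegTwo_eq_span : mulLeftDegTwo K (grading K) = K ∙ LinearMap.mul K (DualNumber K) ε := by
  rw [mulLeftDegTwo, grading_two_eq_span, Submodule.map_span, Set.image_singleton]

/-- `h x = -x₀ + x₁ ε` (`h = -1` on `A_0`, `+1` on `A_2`). [cite: LooijengaLunts1997, §1 (1.4) p. 5 L19–L20] -/
theorem shiftedDegree_apply_eq (x : DualNumber K) :
    shiftedDegree K (grading K) 1 x = -inl x.fst + inr x.snd := by
  have hx : x = inl x.fst + inr x.snd := (inl_fst_add_inr_snd_eq x).symm
  conv_lhs => rw [hx]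
  rw [map_add, shiftedDegree_apply_of_mem K (grading K) 1 (inl_mem_grading_zero x.fst),
    shiftedDegree_apply_of_mem K (grading K) 1 (inr_mem_grading_two x.snd), Nat.cast_zero, Nat.cast_two, Nat.cast_one,
    zero_sub, show (2 : ℤ) - 1 = 1 by norm_num, Int.cast_neg, Int.cast_one, neg_one_smul, one_smul]

/-- `L_ε x = x₀ ε`. [cite: LooijengaLunts1997, §1 (1.4) p. 5 L19–L20] -/
theorem mul_eps_apply_eq (x : DualNumber K) : LinearMap.mul K (DualNumber K) ε x = inr x.fst := by
  rw [LinearMap.mul_apply']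
  exact TrivSqZeroExt.ext (by rw [fst_mul, fst_eps, zero_mul, fst_inr])
    (by rw [DualNumber.snd_mul, fst_eps, snd_eps, zero_mul, zero_add, one_mul, snd_inr])

/-- The lowering operator `f : x₀ + x₁ ε ↦ x₁` (`f ε = 1`, `f 1 = 0`). [cite: LooijengaLunts1997, §1 (1.1) p. 4 L1–L5] -/
theorem lowering_apply_eq (x : DualNumber K) :
    (Algebra.linearMap K (DualNumber K) ∘ₗ TrivSqZeroExt.sndHom K K) x = inl x.snd := by
  rw [LinearMap.comp_apply, sndHom_apply, Algebra.linearMap_apply, algebraMap_eq_inl]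

/-- `c = c·1` in `K[ε]`. [folklore] -/
private theorem inl_eq_smul_one (c : K) : (inl c : DualNumber K) = c • (1 : DualNumber K) :=
  TrivSqZeroExt.ext (by rw [fst_inl, fst_smul, fst_one, smul_eq_mul, mul_one]) (by rw [snd_inl, snd_smul, snd_one, smul_zero])

variable [CharZero K]

/-! ### §4 The degree spaces of `h = deg - 1`; `L_ε` polarizes `(A[1], φ)`; `A` is a Lefschetz algebra of depth `1` -/

/-- `A[1]_{-1} = A_0`. [cite: LooijengaLunts1997, §1 (1.4) p. 5 L19–L20] -/
theorem degreeSpace_neg_one : degreeSpace (shiftedDegree K (grading K) 1) (-1) = grading K 0 := by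
  have h := degreeSpace_shiftedDegree_eq K (grading K) 1 0
  rwa [Nat.cast_zero, Nat.cast_one, zero_sub] at h

/-- `A[1]_{1} = A_2`. [cite: LooijengaLunts1997, §1 (1.4) p. 5 L19–L20] -/
theorem degreeSpace_one : degreeSpace (shiftedDegree K (grading K) 1) 1 = grading K 2 := by
  have h := degreeSpace_shiftedDegree_eq K (grading K) 1 2
  rwa [Nat.cast_two, Nat.cast_one, show (2 : ℤ) - 1 = 1 by norm_num] at h

/-- `A[1]_m = 0` for `m ∉ {-1, 1}`. [cite: LooijengaLunts1997, §1 (1.4) p. 5 L19–L20] -/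
theorem degreeSpace_eq_bot {m : ℤ} (h1 : m ≠ -1) (h2 : m ≠ 1) : degreeSpace (shiftedDegree K (grading K) 1) m = ⊥ := by
  by_cases hm : m < -1
  · exact degreeSpace_shiftedDegree_eq_bot K (grading K) 1 fun i ↦ by omega
  · -- `m = i - 1` with `i = m + 1 ∉ {0, 2}`
    obtain ⟨i, hi⟩ : ∃ i : ℕ, m = (i : ℤ) - 1 := ⟨(m + 1).toNat, by omega⟩
    have h := degreeSpace_shiftedDegree_eq K (grading K) 1 i
    rw [Nat.cast_one] at h
    rw [hi, h]
    exact grading_of_ne K (by omega) (by omega)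

/-- `h ≠ 0` (`h ε = ε`). [cite: LooijengaLunts1997, §1 (1.4) p. 5 L19–L20] -/
theorem shiftedDegree_ne_zero : shiftedDegree K (grading K) 1 ≠ 0 := by
  intro h0
  have h1 := shiftedDegree_apply_of_mem K (grading K) 1 (eps_mem_grading_two (K := K))
  rw [h0, LinearMap.zero_apply, Nat.cast_two, Nat.cast_one, show (2 : ℤ) - 1 = 1 by norm_num, Int.cast_one,
    one_smul] at h1
  exact one_ne_zero ((TrivSqZeroExt.ext_iff.1 h1).2.symm.trans (snd_zero))

/-- **`L_ε` is a polarization of `(A[1], φ)` in the sense of (1.6) / A1-96 (with `J = 1`)**: on the primitive part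
`P_{-k} = Ker(L_ε^{k+1}) ∩ A[1]_{-k}` the form `m ↦ φ(L_ε^k m, m)` has no non-trivial zero — only `P_{-1} = A_0 = K·1` is
non-zero, and `φ(ε·c, c) = c²`. [cite: LooijengaLunts1997, §1 (1.6) p0005 L73–L84] -/
theorem polarization (k : ℕ) (m : DualNumber K)
    (hm : m ∈ primitiveSpace (shiftedDegree K (grading K) 1) (LinearMap.mul K (DualNumber K) ε) k)
    (h0 : lefschetzForm K (grading K) 1 (TrivSqZeroExt.sndHom K K) ((LinearMap.mul K (DualNumber K) ε ^ k) m)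
      ((1 : Module.End K (DualNumber K)) m) = 0) : m = 0 := by
  have hdeg := (HasLefschetzProperty.mem_primitiveSpace_iff.1 hm).1
  by_cases hk : k = 1
  · subst hk
    rw [Nat.cast_one, degreeSpace_neg_one, mem_grading_zero_iff] at hdeg
    rw [pow_one, Module.End.one_apply, lefschetzForm_apply_eq, LinearMap.mul_apply', DualNumber.snd_mul, fst_mul, fst_eps,
      snd_eps, hdeg, zero_mul, zero_add, mul_zero, one_mul, sub_zero, mul_self_eq_zero] at h0
    exact TrivSqZeroExt.ext (h0.trans fst_zero.symm) (hdeg.trans snd_zero.symm)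
  · rw [degreeSpace_eq_bot K (by omega) (by omega), Submodule.mem_bot] at hdeg
    exact hdeg

/-- **`(A_2, A[1])` for `A = K[ε]/(ε²)` IS a Lefschetz module** in the sense of A1-88 (graded by `h = deg - 1`,
`𝔞 = {L_a | a ∈ A_2} = K·L_ε` abelian of degree `2` with the Lefschetz element `L_ε : A_0 ≅ A_2`, `𝔤(𝔞, A) ≅ 𝔰𝔩₂`
semisimple) — obtained from Looijenga–Lunts (1.6) (A1-96 `isLefschetzModule_of_polarization`) with the polarization
`L_ε` of `(A[1], φ)`. [cite: LooijengaLunts1997, §1 (1.6) Proposition p0005 L76–L84] [cite: LooijengaLunts1997, §1 (1.4) p. 5 L17–L20] -/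
theorem isLefschetzModule : IsLefschetzModule K (shiftedDegree K (grading K) 1) (mulLeftDegTwo K (grading K)) := by
  haveI := finiteDimensional K
  refine isLefschetzModule_of_polarization (B := lefschetzForm K (grading K) 1 (TrivSqZeroExt.sndHom K K)) (J := 1)
    (isZGrading_shiftedDegree K (grading K) 1) (shiftedDegree_ne_zero K) (nondegenerate_lefschetzForm K)
    (isRefl_lefschetzForm K) (isSkewAdjoint_lefschetzForm_shiftedDegree 1 fun i hi x hx ↦ sndHom_eq_zero_of_mem K hi hx)
    (mulLeftDegTwo_le_adDegree K (grading K) 1) (isGradedCommutative K).lie_eq_zero_of_mem (fun u hu ↦ ?_)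
    (Commute.one_left _) (fun a _ ↦ Commute.one_left a) (fun x y ↦ rfl) (mul_eps_mem K) (polarization K)
  obtain ⟨a, ha, rfl⟩ := (mem_mulLeftDegTwo_iff K (grading K)).1 hu
  exact isSkewAdjoint_lefschetzForm_mul (isGradedCommutative K) 1 _ ha

/-- **The depth of `A[1]` is `1`** (`A[1]_1 = A_2 = K·ε ≠ 0`, `A[1]_m = 0` for `m ≥ 2`).
[cite: LooijengaLunts1997, §1 (1.4) p. 5 L19–L20] -/
theorem depth_eq_one : depth (shiftedDegree K (grading K) 1) = 1 := by
  have h1 : degreeSpace (shiftedDegree K (grading K) 1) ((1 : ℕ) : ℤ) ≠ ⊥ := by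
    rw [Nat.cast_one, degreeSpace_one, Submodule.ne_bot_iff]
    exact ⟨ε, eps_mem_grading_two, fun h ↦ one_ne_zero ((TrivSqZeroExt.ext_iff.1 h).2.trans snd_zero)⟩
  have hle : ∀ n : ℕ, degreeSpace (shiftedDegree K (grading K) 1) (n : ℤ) ≠ ⊥ → n ≤ 1 := by
    intro n hn
    by_contra hlt
    exact hn (degreeSpace_eq_bot K (by omega) (by omega))
  have hbdd : BddAbove {n : ℕ | degreeSpace (shiftedDegree K (grading K) 1) (n : ℤ) ≠ ⊥} := ⟨1, fun n hn ↦ hle n hn⟩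
  exact le_antisymm (csSup_le ⟨1, h1⟩ fun n hn ↦ hle n hn) (le_csSup hbdd h1)

/-- **`H^•(ℙ¹; K) = K[ε]/(ε²)`, `deg ε = 2`, IS A LEFSCHETZ ALGEBRA OF DEPTH `1`** in the sense of Looijenga–Lunts (1.4)
/ A1-119 `IsLefschetzAlgebra` — a non-vacuity witness for that notion: graded-commutative, `A_0 = K`, `A_i = 0` for
`i > 2`, `A[1]` a Lefschetz module of depth `1` over `A_2`. [cite: LooijengaLunts1997, §1 (1.4) p. 5 L17–L20] -/
theorem isLefschetzAlgebra : IsLefschetzAlgebra K (grading K) 1 where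
  isGradedCommutative := isGradedCommutative K
  exists_algebraMap_eq := fun x hx ↦ by
    rw [grading_zero, LinearMap.mem_range] at hx
    obtain ⟨c, rfl⟩ := hx
    exact ⟨c, rfl⟩
  eq_bot_of_lt := fun i hi ↦ grading_of_ne K (by omega) (by omega)
  isLefschetzModule := isLefschetzModule K
  depth_eq := depth_eq_one K

/-! ### §5 The `𝔰𝔩₂`-triple `(L_ε, h, f)` and the irreducibility of `A[1]` -/

/-- **`(L_ε, h, f)` is an `𝔰𝔩₂`-triple** (`[L_ε, f] = h`, `[h, L_ε] = 2 L_ε`, `[h, f] = -2f`): the Jacobson–Morozov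
partner of the Lefschetz element `L_ε` is `f : ε ↦ 1, 1 ↦ 0`. [cite: LooijengaLunts1997, §1 (1.1) p. 4 L1–L5] -/
theorem isSl2Triple : IsSl2Triple (shiftedDegree K (grading K) 1) (LinearMap.mul K (DualNumber K) ε)
    (Algebra.linearMap K (DualNumber K) ∘ₗ TrivSqZeroExt.sndHom K K) where
  h_ne_zero := shiftedDegree_ne_zero K
  lie_e_f := by
    ext v
    · simp [lowering_apply_eq, shiftedDegree_apply_eq]
    · simp [lowering_apply_eq, shiftedDegree_apply_eq]
  lie_h_e_nsmul := by
    rw [two_nsmul]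
    ext v
    · simp [shiftedDegree_apply_eq]
    · simp [shiftedDegree_apply_eq]
  lie_h_f_nsmul := by
    rw [two_nsmul]
    ext v
    · simp [lowering_apply_eq, shiftedDegree_apply_eq, sub_eq_add_neg]
    · simp [lowering_apply_eq, shiftedDegree_apply_eq]

/-- `f ∈ 𝔤(A_2, A[1])`. [cite: LooijengaLunts1997, §1 (1.1) p. 4 L35–L37] -/
theorem lowering_mem_lefschetzLieAlgebra :
    (Algebra.linearMap K (DualNumber K) ∘ₗ TrivSqZeroExt.sndHom K K) ∈
      lefschetzLieAlgebra K (shiftedDegree K (grading K) 1) (mulLeftDegTwo K (grading K)) :=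
  mem_lefschetzLieAlgebra_of_isSl2Triple (mul_eps_mem K) (isSl2Triple K)

/-- **`A[1]` is irreducible over `𝔤(A_2, A[1])`** (it is the `2`-dimensional simple `𝔰𝔩₂`-module on `1, ε`): a
non-zero stable subspace contains, with `v = v₀ + v₁ ε ≠ 0`, also `L_ε v = v₀ ε`, `f v = v₁`, `L_ε f v = v₁ ε`,
`f L_ε v = v₀`, hence `1` and `ε`.  So `(A[1], φ)` is an irreducible symplectic Lefschetz module ((1.3)).
[cite: LooijengaLunts1997, §1 (1.4) p. 5 L25–L27 ("when A[n] is irreducible as a Lefschetz module")] -/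
theorem isIrreducible : LieModule.IsIrreducible K
    (lefschetzLieAlgebra K (shiftedDegree K (grading K) 1) (mulLeftDegTwo K (grading K))) (DualNumber K) := by
  haveI := finiteDimensional K
  rw [isIrreducible_iff_forall_stable]
  intro V hV
  rcases eq_or_ne V ⊥ with h | h
  · exact Or.inl h
  right
  obtain ⟨v, hv, hv0⟩ := Submodule.exists_mem_ne_zero_of_ne_bot h
  have he := mem_lefschetzLieAlgebra_of_mem (h := shiftedDegree K (grading K) 1) (mul_eps_mem K)
  have hf := lowering_mem_lefschetzLieAlgebra K
  -- `inl c, inr c ∈ V` for `c = v₀` and `c = v₁`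
  have h1 : (inr v.fst : DualNumber K) ∈ V := by
    have := hV _ he v hv
    rwa [mul_eps_apply_eq] at this
  have h2 : (inl v.snd : DualNumber K) ∈ V := by
    have := hV _ hf v hv
    rwa [lowering_apply_eq] at this
  have h3 : (inr v.snd : DualNumber K) ∈ V := by
    have := hV _ he _ h2
    rwa [mul_eps_apply_eq, fst_inl] at this
  have h4 : (inl v.fst : DualNumber K) ∈ V := by
    have := hV _ hf _ h1
    rwa [lowering_apply_eq, snd_inr] at this
  -- some coordinate `c ≠ 0`, and then `1, ε ∈ V`
  obtain ⟨c, hc, hlc, hrc⟩ : ∃ c : K, c ≠ 0 ∧ (inl c : DualNumber K) ∈ V ∧ (inr c : DualNumber K) ∈ V := by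
    by_cases h0 : v.fst = 0
    · refine ⟨v.snd, fun h' ↦ hv0 (TrivSqZeroExt.ext (h0.trans fst_zero.symm) (h'.trans snd_zero.symm)), h2, h3⟩
    · exact ⟨v.fst, h0, h4, h1⟩
  rw [inl_eq_smul_one] at hlc
  rw [inr_eq_smul_eps] at hrc
  have hone : (1 : DualNumber K) ∈ V := by
    have := Submodule.smul_mem V c⁻¹ hlc
    rwa [smul_smul, inv_mul_cancel₀ hc, one_smul] at this
  have heps : (ε : DualNumber K) ∈ V := by
    have := Submodule.smul_mem V c⁻¹ hrc
    rwa [smul_smul, inv_mul_cancel₀ hc, one_smul] at this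
  rw [eq_top_iff]
  rintro x -
  rw [← inl_fst_add_inr_snd_eq x, inl_eq_smul_one, inr_eq_smul_eps]
  exact Submodule.add_mem V (Submodule.smul_mem V _ hone) (Submodule.smul_mem V _ heps)

end Model

end Literature.Algebra.Lie.LefschetzDualNumber

end
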